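import Mathlib

/-!
# Ladder duality (swap the sides, reverse the class order) — substitution-certificate form

Support file for item `stmt-MatrixMultiplication-14308` (`FourierTwoFamiliesModP.PrimeTwoFamilies`,
CKSU 2005 Conj. 4.7 with prime cyclic hosts), line `Sketch`, registered stub `isLadder_reverse`
(siege attempt k16, variation "certificate on the finite core").

A LADDER is an ordered family `(X c, Y c)_{c < r}` of finite subsets of an abelian group `G` with

* (directness, `hW`) `(x - x') + (y - y') = 0 → x = x' ∧ y = y'` for `x, x' ∈ X c`, `y, y' ∈ Y c`;
* (one-directional separation, `hL`) for `p < q`, every lower cross difference `y' - x'`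
  (`x' ∈ X p`, `y' ∈ Y q`) avoids every diagonal difference `y - x` (`x ∈ X c`, `y ∈ Y c`).

The dual family `c ↦ (Y (Fin.rev c), X (Fin.rev c))` is again a ladder (`isLadder_reverse`), which
transfers every right-side ladder lemma of the line to the left side.

Design.  The statement ranges over an arbitrary abelian group, so nothing is settled by enumeration;
the finite core is the index type `Fin r`, and the proof is an explicit CERTIFICATE: the substitution
`(c, p, q; x, y, x', y') ↦ (rev c, rev q, rev p; y, x, y', x')` sends each dual obligation to a primal
hypothesis.  The only fact used about the core is the order reversal `p < q ↔ rev q < rev p`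
(`Fin.rev_lt_rev`); the relations are matched by the group identities
`(y - y') + (x - x') = (x - x') + (y - y')` (`add_comm`) and `x - y = -(y - x)` (`neg_sub`).
The proof is a closed term (no tactic search), so the certificate is checked by the kernel as written.

Not here: anything else of the line (packing, shapes, lex products, the transfer to prime hosts).
The file declares the registered stub and nothing else; an independent proof of the same statement
by the line's lead lives in `…Theorems.PrimeTwoFamilies.LadderLift`.
-/

-- single-conjunct summit: the mandated namespace repeats `MatrixMultiplication` (summit = sub-problem).
set_option linter.dupNamespace false

namespace Summit.MatrixMultiplication.MatrixMultiplication.Theorems.PrimeTwoFamilies.LadderReverseK16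

/-- **Ladder duality** (registered stub `isLadder_reverse` of crux `PrimeTwoFamilies`, line `Sketch`).
If `(X c, Y c)_{c < r}` is a ladder — every class direct (`hW`) and the family one-directionally
separated (`hL`) — then so is the dual family `c ↦ (Y (Fin.rev c), X (Fin.rev c))`: swapping the two
sides negates every difference `y - x`, and reversing the class order restores the orientation
`p < q`.  Certificate: `(c, p, q; x, y, x', y') ↦ (rev c, rev q, rev p; y, x, y', x')`. -/
theorem isLadder_reverse {G : Type*} [AddCommGroup G] {r : ℕ} (X Y : Fin r → Finset G)
    (hW : ∀ c : Fin r, ∀ x ∈ X c, ∀ x' ∈ X c, ∀ y ∈ Y c, ∀ y' ∈ Y c,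
      (x - x') + (y - y') = 0 → x = x' ∧ y = y')
    (hL : ∀ c p q : Fin r, p < q → ∀ x ∈ X c, ∀ y ∈ Y c, ∀ x' ∈ X p, ∀ y' ∈ Y q,
      y - x ≠ y' - x') :
    (∀ c : Fin r, ∀ x ∈ Y (Fin.rev c), ∀ x' ∈ Y (Fin.rev c), ∀ y ∈ X (Fin.rev c),
        ∀ y' ∈ X (Fin.rev c), (x - x') + (y - y') = 0 → x = x' ∧ y = y') ∧
    (∀ c p q : Fin r, p < q → ∀ x ∈ Y (Fin.rev c), ∀ y ∈ X (Fin.rev c),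
        ∀ x' ∈ Y (Fin.rev p), ∀ y' ∈ X (Fin.rev q), y - x ≠ y' - x') :=
  ⟨-- directness of the dual class `c`: primal class `rev c`, sides swapped, summands commuted.
    fun c x hx x' hx' y hy y' hy' h =>
      (hW (Fin.rev c) y hy y' hy' x hx x' hx' ((add_comm (y - y') (x - x')).trans h)).symm,
    -- separation of the dual pair `p < q`: primal classes `rev c; rev q < rev p`, sides swapped,
    -- and the forbidden coincidence `y - x = y' - x'` negated to `x - y = x' - y'`.
    fun c p q hpq x hx y hy x' hx' y' hy' h =>
      hL (Fin.rev c) (Fin.rev q) (Fin.rev p) (Fin.rev_lt_rev.2 hpq) y hy x hx y' hy' x' hx'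
        ((neg_sub y x).symm.trans ((congrArg Neg.neg h).trans (neg_sub y' x')))⟩

end Summit.MatrixMultiplication.MatrixMultiplication.Theorems.PrimeTwoFamilies.LadderReverseK16
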